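import Literature.AlgebraicGeometry.GroupSchemes.CartierDualFiniteFlat
import Literature.AlgebraicGeometry.GroupSchemes.AffineGroupSchemeBaseChangeHopf
import Literature.RingTheory.HopfAlgebra.FiniteDualTranspose
import Literature.RingTheory.HopfAlgebra.FiniteDualBaseChangeBialgebra
import HarnessLib

/-!
# The Cartier dual algebra commutes with base change: `Γ(G_{R′})^* ≃ₐc (R′ ⊗ Γ(G))^* ≃ₐc R′ ⊗ Γ(G)^*` (Tate 1997 §(3.8) «`(A_B)′ = A′_B`»)

Layer `Literature/AlgebraicGeometry/GroupSchemes`, namespace `Literature.AlgebraicGeometry.GroupSchemes.AffineGroupScheme` (continues ★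
`CartierDualFiniteFlat` p845244 ∕ p845403 — `DualAlg G = WithConv (Dual R (Alg G))` with its Hopf instances —, ★ `AffineGroupSchemeBaseChangeAlg ∕
…Hopf` p845472 ∕ p845509 — `algBaseChangeEquiv ∕ algBaseChangeBialgEquiv R′ G : Alg G_{R′} ≃ R′ ⊗[R] Alg G` —, ★ CD3-equiv `FiniteDualTranspose` p845371
— `transposeBialgEquiv` — and ★ CD2-bcc `FiniteDualBaseChangeBialgebra` — `exists_bialgEquiv_dualBaseChange`).  One `def` (`dualAlgBaseChangeEquiv`)
+ theorems; no instance, no notation, no named fact, no `sorry`.  Cell `hodgecm-mathlib` (D-0151), programme P6 «MOD», HEART organ (g1) rider (b)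
step 3a of B-p04 (g37) (the ALGEBRA side of `(G_{R′})^D ≅ (G^D)_{R′}`; LEAD F0P6-plan (g0) 16:15:19Z rider order (a)→(b)→(c)).  Count-neutral
Mathlib-side capital: HC_CM is proved only modulo the 7 printed citations until rung 0 closes; nothing here bears on it.

THE PRINT ([Tate1997FiniteFlatGroupSchemes] §(3.8) p. 145: «for an `R`-algebra `B`, `(A_B)′ = A′_B`», i.e. `(G ×_R R′)^D = G^D ×_R R′`).  For the base
change `G_{R′} := (Over.pullback (Spec R′ → Spec R)).obj G` (Mathlib's transported group object, scoped instance `CategoryTheory.Obj`) of a finite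
free commutative affine group scheme `G` over `R`:

* §1 `free_alg_baseChange`, `finite_alg_baseChange` (`Γ(G_{R′}) ≃ R′ ⊗ Γ(G)` is finite free over `R′`; instance-form inputs for `DualAlg G_{R′}`);
* §2 **`dualAlgBaseChangeEquiv R′ G : DualAlg G_{R′} ≃ₐc[R′] (R′ ⊗_R Γ(G))^*`** (`:= transposeBialgEquiv (algBaseChangeBialgEquiv R′ G).symm`;
  `_apply_apply : (Φ φ)(z) = φ (e⁻¹ z)`);
* §3 HEAD **`exists_bialgEquiv_tensor_dualAlg`**: `∃ Ψ : R′ ⊗[R] DualAlg G ≃ₐc[R′] DualAlg G_{R′}` with `(dualAlgBaseChangeEquiv (Ψ (r ⊗ μ))) = r • μ_{R′}`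
  (`μ_{R′}` = ★ `Tannakian.dualBaseChange R′ μ`, `μ_{R′}(s ⊗ a) = μ(a) s`) — `(A^*)_{R′} ≅ (A_{R′})^*` as bialgebras over `R′` (★ CD2-bcc composed
  with §2); the `∃`-form is inherited from ★ `exists_bialgEquiv_dualBaseChange`.

NOT here (step 3b): `Spec` of §3, i.e. the isomorphism of group schemes `cartierDual (G_{R′}) ≅ (cartierDual G)_{R′}` over `R′`.

## References
* [Tate1997FiniteFlatGroupSchemes] J. Tate, *Finite flat group schemes*, in: Modular Forms and Fermat's Last Theorem (1997), §(3.8) p. 145.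
* [GortzWedhorn2023] U. Görtz, T. Wedhorn, *Algebraic Geometry II* (2023), §(27.2) (pp. 606–607).
-/

set_option autoImplicit false

-- Mathlib's `Over`/`Scheme` APIs are stated across semireducible wrappers (as in the ★ `GroupSchemes/*` files).
set_option backward.isDefEq.respectTransparency false

universe u

open CategoryTheory CategoryTheory.Limits AlgebraicGeometry MonoidalCategory CartesianMonoidalCategory TensorProduct WithConv

noncomputable section

namespace Literature.AlgebraicGeometry.GroupSchemes

namespace AffineGroupScheme

open scoped MonObj CategoryTheory.Obj

open Literature.AlgebraicGeometry.Motives Literature.NumberTheory.DiophantineGeometry Literature.RingTheory.HopfAlgebra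

variable {R : Type u} [CommRing R] (R' : Type u) [CommRing R'] [Algebra R R'] (G : SchemeOver R) [GrpObj G] [IsAffine G.left]
  [IsAffine ((Over.pullback (Spec.map (CommRingCat.ofHom (algebraMap R R')))).obj G).left]

/-! ## §1 `Γ(G_{R′})` is finite free over `R′` -/

/-- `Γ(G_{R′}, 𝒪)` is a free `R′`-module when `Γ(G, 𝒪)` is free over `R` (★ `algBaseChangeEquiv` + Mathlib base change of free modules).
[cite: Tate1997FiniteFlatGroupSchemes, §(3.8) p. 145] -/
theorem free_alg_baseChange [Module.Free R (Alg G)] :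
    Module.Free R' (Alg ((Over.pullback (Spec.map (CommRingCat.ofHom (algebraMap R R')))).obj G)) :=
  Module.Free.of_equiv (algBaseChangeEquiv R' G).symm.toLinearEquiv

/-- `Γ(G_{R′}, 𝒪)` is a finite `R′`-module when `Γ(G, 𝒪)` is finite over `R`. [cite: Tate1997FiniteFlatGroupSchemes, §(3.8) p. 145] -/
theorem finite_alg_baseChange [Module.Finite R (Alg G)] :
    Module.Finite R' (Alg ((Over.pullback (Spec.map (CommRingCat.ofHom (algebraMap R R')))).obj G)) :=
  Module.Finite.equiv (algBaseChangeEquiv R' G).symm.toLinearEquiv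

/-! ## §2 `Γ(G_{R′})^* ≃ₐc (R′ ⊗ Γ(G))^*` -/

section Dual

variable [Module.Free R (Alg G)] [Module.Finite R (Alg G)]
  [IsCommMonObj ((Over.pullback (Spec.map (CommRingCat.ofHom (algebraMap R R')))).obj G)]
  [Module.Free R' (Alg ((Over.pullback (Spec.map (CommRingCat.ofHom (algebraMap R R')))).obj G))]
  [Module.Finite R' (Alg ((Over.pullback (Spec.map (CommRingCat.ofHom (algebraMap R R')))).obj G))]

/-- **`Γ(G_{R′})^* ≃ₐc[R′] (R′ ⊗_R Γ(G))^*`**: the transpose of `Γ(G_{R′}) ≃ₐc R′ ⊗ Γ(G)` (★ `algBaseChangeBialgEquiv`, ★ `transposeBialgEquiv`), for the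
Hopf structure ★ `DualAlg.instHopfAlgebra` of `Γ(G_{R′})^*` and the dual bialgebra `FiniteDual.bialgebra R′ (R′ ⊗ Γ(G))` of Mathlib's base-change
bialgebra. [cite: Tate1997FiniteFlatGroupSchemes, §(3.8) p. 145] -/
def dualAlgBaseChangeEquiv :
    letI := FiniteDual.bialgebra R' (R' ⊗[R] Alg G)
    DualAlg ((Over.pullback (Spec.map (CommRingCat.ofHom (algebraMap R R')))).obj G) ≃ₐc[R'] WithConv (Module.Dual R' (R' ⊗[R] Alg G)) :=
  FiniteDual.transposeBialgEquiv (algBaseChangeBialgEquiv R' G).symm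

/-- `(dualAlgBaseChangeEquiv φ)(z) = φ (e⁻¹ z)` with `e := algBaseChangeEquiv`. [cite: Tate1997FiniteFlatGroupSchemes, §(3.8) p. 145] -/
theorem dualAlgBaseChangeEquiv_apply_apply
    (φ : DualAlg ((Over.pullback (Spec.map (CommRingCat.ofHom (algebraMap R R')))).obj G)) (z : R' ⊗[R] Alg G) :
    letI := FiniteDual.bialgebra R' (R' ⊗[R] Alg G)
    dualAlgBaseChangeEquiv R' G φ z = WithConv.ofConv φ ((algBaseChangeEquiv R' G).symm z) := rfl

/-! ## §3 `R′ ⊗_R Γ(G)^* ≃ₐc Γ(G_{R′})^*` -/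

/-- **HEAD — `(A^*)_{R′} ≅ (A_{R′})^*` for `A = Γ(G)`**: a bialgebra isomorphism `Ψ : R′ ⊗_R Γ(G)^* ≃ₐc[R′] Γ(G_{R′})^*` characterised by
`dualAlgBaseChangeEquiv (Ψ (r ⊗ μ)) = r • μ_{R′}` (`μ_{R′} :=` ★ `Tannakian.dualBaseChange R′ μ`, `μ_{R′}(s ⊗ a) = μ(a) s`); ★ CD2-bcc
`exists_bialgEquiv_dualBaseChange` followed by §2.  [Tate1997FiniteFlatGroupSchemes] §(3.8): «`(A_B)′ = A′_B`».
[cite: Tate1997FiniteFlatGroupSchemes, §(3.8) p. 145] -/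
theorem exists_bialgEquiv_tensor_dualAlg [IsCommMonObj G] :
    letI := FiniteDual.bialgebra R' (R' ⊗[R] Alg G)
    ∃ Ψ : R' ⊗[R] DualAlg G ≃ₐc[R'] DualAlg ((Over.pullback (Spec.map (CommRingCat.ofHom (algebraMap R R')))).obj G),
      ∀ (r : R') (f : DualAlg G),
        dualAlgBaseChangeEquiv R' G (Ψ (r ⊗ₜ f)) =
          r • Tannakian.dualBaseChange (R := R) (A := Alg G) R' (show WithConv (Module.Dual R (Alg G)) from f) := by
  letI := FiniteDual.bialgebra R' (R' ⊗[R] Alg G)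
  letI : Bialgebra R (WithConv (Module.Dual R (Alg G))) := FiniteDual.bialgebra R (Alg G)
  obtain ⟨e₀, he₀⟩ := exists_bialgEquiv_dualBaseChange (R := R) R' (B := Alg G)
  refine ⟨e₀.trans (dualAlgBaseChangeEquiv R' G).symm, fun r f => ?_⟩
  change dualAlgBaseChangeEquiv R' G ((dualAlgBaseChangeEquiv R' G).symm (e₀ (r ⊗ₜ f))) = _
  rw [BialgEquiv.apply_symm_apply]
  exact he₀ r f

end Dual

end AffineGroupScheme

end Literature.AlgebraicGeometry.GroupSchemes

end
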